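import Mathlib
import Literature.Analysis.Fourier.HolomorphicParamIntegral
import Literature.Analysis.DeBrangesSpaces.BurnolSonineSpaces
import HarnessLib

/-!
# Burnol's cosine kernel `C_a(u,w) = 2∫_a^∞ cos(2πut) t^{w−1} dt`: entire continuation in `w`, the
# uniform `O(1/u)` bound, and the terminating integration by parts at `w = 1 + 2j`

LINE 1 — LABEL: RH-FREE (elementary real/complex analysis of an oscillatory integral; the Riemann zeta
function does not occur). FRAMING (cell rh-crit, D-0074): corpus theorems are RH-FREE literature; nothing
here is worded as progress toward RH. bears_on: B-C/B-P (LADDER-RH COLUMN 6, de Branges framework —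
this is the analytic engine of de Branges' 1964 theorem "Mellin transforms of Sonine functions are entire",
Burnol 2004 Thm. 2.1 / Burnol 2001 Thm. 1.1). WHAT THIS IS NOT: not a route, not a criterion; nothing here
bears on the truth of RH.

Source: J.-F. Burnol, *Sur certains espaces de Hilbert de fonctions entières, liés à la transformation de
Fourier et aux fonctions L de Dirichlet et de Riemann*, C. R. Acad. Sci. Paris Sér. I **333** (2001)
201–206 = arXiv:math/0105120 [Burnol2001CRAS], §1, TeX of record
`dbl/src/Burnol2001CRAS_arXivmath0105120.tex` l.320–367: the identity (1.2), the integration-by-parts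
relation "`Re(w) < 0 ⇒ 2∫_a^∞ cos(2πut)t^{w−1}dt = ((1−w)∫_a^∞ sin(2πut)t^{w−2}dt − a^{w−1}sin(2πau))/(πu)`",
Lemme 1.2 (`C_a(u,·)` is entire) and the `O(1/u)`-clause and the last clause of Lemme 1.3.

## What is PROVED here (no named facts are introduced)

We work with the complex-exponential halves `J(λ,a,z) "=" ∫_a^∞ e^{iλt} t^z dt` (`λ = ±2πu`, `z = w − 1`),
so that `C_a(u,w) = J(2πu,a,w−1) + J(−2πu,a,w−1)` (`SonineMellin.cosKernel`):

* `SonineMellin.ibpEntire` — the ENTIRE continuation of `z ↦ ∫_a^∞ e^{iλt}t^z dt` from `Re z < −1`,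
  constructed by `N`-fold integration by parts (`ibpLevel`, holomorphic on `Re z < N − 1`, all levels
  consistent) and gluing; `differentiable_ibpEntire` (= Lemme 1.2), `ibpEntire_eq_integral`.
* `exists_bound_ibpEntire` / `exists_bound_cosKernel` — `‖J(λ,a,z)‖ ≤ K/|λ|` uniformly for `|λ| ≥ λ₀`,
  `‖z‖ ≤ R` (the `O(1/u)` clause of Lemme 1.3, which is what makes `u ↦ C_a(u,w)` square integrable on
  `(b,∞)` locally uniformly in `w`).
* `ibpEntire_add_ibpEntire_neg_even` / `cosKernel_one_add_two_mul` — at `w = 1 + 2j` the integration by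
  parts terminates and `C_a(u,1+2j) = −2∫_0^a cos(2πut)t^{2j}dt` (the clause
  "`C_a(u,1+2j) = −𝓕₊(𝟙_{t≤a}t^{2j})(u)`" of Lemme 1.3; this is where the TRIVIAL ZEROS of Mellin transforms
  of Sonine functions come from, see `SonineMellinEntire.lean`).
* `Burnol2001.Burnol2001CRAS_lem1_2_holds` — DISCHARGE of the named fact
  `Literature.Analysis.DeBrangesSpaces.Burnol2001.Burnol2001CRAS_lem1_2` (typed in `BurnolSonineSpaces.lean`)
  by `cosKernel` (`cosKernel_eq_burnolC`).
* `SonineMellin.sonineMellinExt a b F w = ∫_b^∞ F(u) C_a(u,w) du` — the candidate entire continuation of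
  the Mellin transform of a Sonine function (Burnol's right-hand side of (1.2)), studied in
  `SonineMellinEntire.lean`.

DEVIATION FROM THE PRINTED ROUTE (stated, not hidden): Burnol obtains the closed form (1.3)
`C_a(u,w) = γ₊(w)u^{−w} − 2Σ_j (−1)^j(2πu)^{2j}a^{2j+w}/((2j)!(2j+w))` from the Mellin–Plancherel identity
(1.1) and reads off the values at `1 + 2j` from `γ₊(1+2j) = 0`; we do not need the Mellin transform of
`cos` and instead evaluate the terminating integration by parts directly (the two `t = 0` boundary terms
`∓(2j)!·i^{2j+1}/λ^{2j+1}` cancel). The `γ₊`-clause of Lemme 1.3 (`Burnol2001CRAS_lem1_3` (i)) is NOT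
proved here.
-/

noncomputable section

open _root_.MeasureTheory _root_.Complex _root_.Filter _root_.Set
open scoped Topology Real

namespace Literature.Analysis.DeBrangesSpaces

namespace SonineMellin

/-- RH-FREE object (proof device). The coefficient `c_k(z) = ∏_{j<k} (−(z−j)/(iλ))` produced by `k`
integrations by parts of `∫_a^∞ e^{iλt} t^z dt` (differentiate the power, integrate the exponential).
[cite: Burnol2001CRAS, Lemme 1.2 and eq. (1.2) (TeX l.320–355)] -/
def ibpCoef (l : ℝ) (z : ℂ) (k : ℕ) : ℂ :=
  ∏ j ∈ Finset.range k, (-(z - (j : ℂ)) / (I * l))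

/-- RH-FREE object (proof device). The boundary term `−e^{iλa} a^z/(iλ)` of one integration by parts of
`∫_a^∞ e^{iλt} t^z dt` at the endpoint `t = a` (the term at `∞` vanishes for `Re z < 0`). [cite: Burnol2001CRAS, Lemme 1.2 and eq. (1.2) (TeX l.320–355)] -/
def ibpBoundary (l a : ℝ) (z : ℂ) : ℂ :=
  -(cexp (I * l * a) * (a : ℂ) ^ z / (I * l))

/-- RH-FREE object (proof device). The tail `∫_a^∞ e^{iλt} t^{z−N} dt` left after `N` integrations by parts
(a Bochner integral, absolutely convergent for `Re z < N − 1`). [cite: Burnol2001CRAS, Lemme 1.2 and eq. (1.2) (TeX l.320–355)] -/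
def ibpTail (l a : ℝ) (z : ℂ) (N : ℕ) : ℂ :=
  ∫ t in Ioi a, cexp (I * l * t) * (t : ℂ) ^ (z - N)

/-- RH-FREE object (proof device). The level-`N` continuation
`J_N(λ,a,z) = Σ_{k<N} c_k(z)·bnd(λ,a,z−k) + c_N(z)·∫_a^∞ e^{iλt}t^{z−N}dt` of `∫_a^∞ e^{iλt} t^z dt`,
holomorphic on `Re z < N − 1`; Burnol: the integration-by-parts relations "établissent que ces fonctions
sont des fonctions entières de `w`". [cite: Burnol2001CRAS, Lemme 1.2 and eq. (1.2) (TeX l.320–355)] -/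
def ibpLevel (l a : ℝ) (N : ℕ) (z : ℂ) : ℂ :=
  (∑ k ∈ Finset.range N, ibpCoef l z k * ibpBoundary l a (z - k)) + ibpCoef l z N * ibpTail l a z N

/-- `d/dt e^{iλt} = iλ e^{iλt}` (real variable). [folklore] -/
private theorem hasDerivAt_cexp_mul (l : ℝ) (t : ℝ) :
    HasDerivAt (fun x : ℝ ↦ cexp (I * l * x)) (I * l * cexp (I * l * t)) t := by
  have h1 : HasDerivAt (fun x : ℝ ↦ (I * l) * (x : ℂ)) (I * l * 1) t :=
    (hasDerivAt_id t).ofReal_comp.const_mul (I * l)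
  have h2 := h1.cexp
  simpa [mul_comm] using h2

/-- `|e^{iλt}| = 1` for real `λ, t`. [folklore] -/
private theorem norm_cexp_I_mul (l t : ℝ) : ‖cexp (I * l * t)‖ = 1 := by
  rw [show (I * l * t : ℂ) = ((l * t : ℝ) : ℂ) * I by push_cast; ring]
  exact Complex.norm_exp_ofReal_mul_I _

/-- `e^{iλt} t^c` is integrable on `(a,∞)`, `a > 0`, when `Re c < −1`. [folklore] -/
private theorem integrableOn_cexp_mul_cpow {l a : ℝ} (ha : 0 < a) {c : ℂ} (hc : c.re < -1) :
    IntegrableOn (fun t : ℝ ↦ cexp (I * l * t) * (t : ℂ) ^ c) (Ioi a) := by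
  have h := integrableOn_Ioi_cpow_of_lt hc ha
  refine Integrable.bdd_mul (c := 1) h ?_ ?_
  · exact (Continuous.aestronglyMeasurable (by fun_prop))
  · exact Eventually.of_forall fun t ↦ (norm_cexp_I_mul l t).le

/-- One integration by parts on `(a, ∞)`:
`∫_a^∞ e^{iλt}t^c dt = −e^{iλa}a^c/(iλ) − (c/(iλ))∫_a^∞ e^{iλt}t^{c−1}dt` (`Re c < −1`, `λ ≠ 0`, `a > 0`);
Burnol's "calcul (immédiat) par intégration par parties". [cite: Burnol2001CRAS, Lemme 1.2 and eq. (1.2) (TeX l.320–355)] -/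
theorem ibp_step {l a : ℝ} (hl : l ≠ 0) (ha : 0 < a) {c : ℂ} (hc : c.re < -1) :
    ∫ t in Ioi a, cexp (I * l * t) * (t : ℂ) ^ c =
      -(cexp (I * l * a) * (a : ℂ) ^ c / (I * l)) +
        (-(c / (I * l))) * ∫ t in Ioi a, cexp (I * l * t) * (t : ℂ) ^ (c - 1) := by
  have hIl : (I * l : ℂ) ≠ 0 := mul_ne_zero I_ne_zero (ofReal_ne_zero.mpr hl)
  have hc0 : c ≠ 0 := by
    intro h; rw [h] at hc; simp at hc; linarith
  -- P(t) = e^{iλt}/(iλ) · t^c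
  set P : ℝ → ℂ := fun t ↦ cexp (I * l * t) / (I * l) * (t : ℂ) ^ c with hP
  set P' : ℝ → ℂ := fun t ↦ cexp (I * l * t) * (t : ℂ) ^ c +
    cexp (I * l * t) / (I * l) * (c * (t : ℂ) ^ (c - 1)) with hP'
  have hderiv : ∀ x ∈ Ici a, HasDerivAt P (P' x) x := by
    intro x hx
    have hx0 : x ≠ 0 := (ha.trans_le hx).ne'
    have h1 : HasDerivAt (fun t : ℝ ↦ cexp (I * l * t) / (I * l)) (cexp (I * l * x)) x := by
      refine ((hasDerivAt_cexp_mul l x).div_const (I * l)).congr_deriv ?_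
      exact mul_div_cancel_left₀ _ hIl
    have h2 := hasDerivAt_ofReal_cpow_const hx0 hc0
    exact h1.mul h2
  have hint1 : IntegrableOn (fun t : ℝ ↦ cexp (I * l * t) * (t : ℂ) ^ c) (Ioi a) :=
    integrableOn_cexp_mul_cpow ha hc
  have hint2 : IntegrableOn (fun t : ℝ ↦ cexp (I * l * t) * (t : ℂ) ^ (c - 1)) (Ioi a) :=
    integrableOn_cexp_mul_cpow ha (by simp; linarith)
  have hint2' : IntegrableOn (fun t : ℝ ↦ cexp (I * l * t) / (I * l) * (c * (t : ℂ) ^ (c - 1)))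
      (Ioi a) := by
    have h3 : IntegrableOn (fun t : ℝ ↦ c / (I * l) * (cexp (I * l * t) * (t : ℂ) ^ (c - 1)))
        (Ioi a) := hint2.const_mul (c / (I * l))
    refine h3.congr_fun (fun t _ ↦ ?_) measurableSet_Ioi
    simp only [div_eq_mul_inv]; ring
  have hP'int : IntegrableOn P' (Ioi a) := hint1.add hint2'
  have hlim : Tendsto P atTop (𝓝 0) := by
    rw [tendsto_zero_iff_norm_tendsto_zero]
    have h1 : Tendsto (fun t : ℝ ↦ t ^ c.re / ‖(I * l : ℂ)‖) atTop (𝓝 0) := by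
      have := (tendsto_rpow_neg_atTop (y := -c.re) (by linarith)).div_const ‖(I * l : ℂ)‖
      simpa using this
    refine h1.congr' ?_
    filter_upwards [Ioi_mem_atTop 0] with t ht
    rw [hP]
    simp only [norm_mul, norm_div, norm_cexp_I_mul, norm_cpow_eq_rpow_re_of_pos ht]
    ring
  have key := integral_Ioi_of_hasDerivAt_of_tendsto' hderiv hP'int hlim
  rw [hP', integral_add hint1 hint2'] at key
  have e2 : ∫ t in Ioi a, cexp (I * l * t) / (I * l) * (c * (t : ℂ) ^ (c - 1)) =
      (c / (I * l)) * ∫ t in Ioi a, cexp (I * l * t) * (t : ℂ) ^ (c - 1) := by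
    rw [← integral_const_mul]
    refine setIntegral_congr_fun measurableSet_Ioi (fun t _ ↦ ?_)
    simp only [div_eq_mul_inv]; ring
  rw [e2] at key
  have hPa : P a = cexp (I * l * a) / (I * l) * (a : ℂ) ^ c := rfl
  rw [hPa] at key
  -- solve the linear equation
  have : ∫ t in Ioi a, cexp (I * l * t) * (t : ℂ) ^ c =
      0 - cexp (I * l * a) / (I * l) * (a : ℂ) ^ c -
        (c / (I * l)) * ∫ t in Ioi a, cexp (I * l * t) * (t : ℂ) ^ (c - 1) := by
    rw [← key]; ring
  rw [this, zero_sub, div_eq_mul_inv, div_eq_mul_inv, div_eq_mul_inv]; ring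

/-- The recursion `c_{k+1}(z) = c_k(z)·(−(z−k)/(iλ))`. [cite: Burnol2001CRAS, Lemme 1.2 and eq. (1.2) (TeX l.320–355)] -/
theorem ibpCoef_succ (l : ℝ) (z : ℂ) (k : ℕ) :
    ibpCoef l z (k + 1) = ibpCoef l z k * (-(z - (k : ℂ)) / (I * l)) := by
  rw [ibpCoef, Finset.prod_range_succ, ibpCoef]

/-- `c_0 = 1`. [cite: Burnol2001CRAS, Lemme 1.2 and eq. (1.2) (TeX l.320–355)] -/
theorem ibpCoef_zero (l : ℝ) (z : ℂ) : ibpCoef l z 0 = 1 := by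
  simp [ibpCoef]

/-- The tail recursion `tail_N = bnd(z−N) + (−(z−N)/(iλ))·tail_{N+1}` on `Re z < N − 1`. [cite: Burnol2001CRAS, Lemme 1.2 and eq. (1.2) (TeX l.320–355)] -/
theorem ibpTail_succ {l a : ℝ} (hl : l ≠ 0) (ha : 0 < a) {z : ℂ} {N : ℕ} (hz : z.re < N - 1) :
    ibpTail l a z N = ibpBoundary l a (z - N) + (-((z - N) / (I * l))) * ibpTail l a z (N + 1) := by
  have hc : (z - (N : ℂ)).re < -1 := by simp; linarith
  rw [ibpTail, ibp_step hl ha hc, ibpBoundary, ibpTail]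
  congr 3
  ext t; congr 1; push_cast; ring_nf

/-- Consistency of consecutive levels: `J_{N+1} = J_N` on `Re z < N − 1`. [cite: Burnol2001CRAS, Lemme 1.2 and eq. (1.2) (TeX l.320–355)] -/
theorem ibpLevel_succ {l a : ℝ} (hl : l ≠ 0) (ha : 0 < a) {z : ℂ} {N : ℕ} (hz : z.re < N - 1) :
    ibpLevel l a (N + 1) z = ibpLevel l a N z := by
  rw [ibpLevel, ibpLevel, Finset.sum_range_succ, ibpCoef_succ, ibpTail_succ hl ha hz]
  ring

/-- Consistency of all levels `M ≥ N` on `Re z < N − 1`. [cite: Burnol2001CRAS, Lemme 1.2 and eq. (1.2) (TeX l.320–355)] -/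
theorem ibpLevel_eq_of_le {l a : ℝ} (hl : l ≠ 0) (ha : 0 < a) {z : ℂ} {N M : ℕ} (hNM : N ≤ M)
    (hz : z.re < N - 1) : ibpLevel l a M z = ibpLevel l a N z := by
  induction M, hNM using Nat.le_induction with
  | base => rfl
  | succ M hNM ih =>
    rw [ibpLevel_succ hl ha (by linarith [show (N : ℝ) ≤ M from by exact_mod_cast hNM])]
    exact ih

/-- Level zero is the bare integral `∫_a^∞ e^{iλt} t^z dt`. [cite: Burnol2001CRAS, Lemme 1.2 and eq. (1.2) (TeX l.320–355)] -/
theorem ibpLevel_zero (l a : ℝ) (z : ℂ) :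
    ibpLevel l a 0 z = ∫ t in Ioi a, cexp (I * l * t) * (t : ℂ) ^ z := by
  simp [ibpLevel, ibpCoef, ibpTail]


/-! ## K2: holomorphy of the levels and the glued entire kernel -/

/-- `z ↦ c_k(z)` is a polynomial, hence entire. [cite: Burnol2001CRAS, Lemme 1.2 and eq. (1.2) (TeX l.320–355)] -/
theorem differentiable_ibpCoef (l : ℝ) (k : ℕ) : Differentiable ℂ (fun z ↦ ibpCoef l z k) := by
  unfold ibpCoef
  apply Differentiable.fun_finsetProd
  intro j _
  fun_prop

/-- `z ↦ bnd(λ,a,z)` is entire (`a > 0`). [cite: Burnol2001CRAS, Lemme 1.2 and eq. (1.2) (TeX l.320–355)] -/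
theorem differentiable_ibpBoundary (l : ℝ) {a : ℝ} (ha : 0 < a) :
    Differentiable ℂ (fun z ↦ ibpBoundary l a z) := by
  unfold ibpBoundary
  have h : Differentiable ℂ (fun z : ℂ ↦ (a : ℂ) ^ z) := fun z ↦
    (differentiableAt_id).const_cpow (Or.inl (ofReal_ne_zero.mpr ha.ne'))
  fun_prop

/-- The tail `z ↦ ∫_a^∞ e^{iλt}t^{z−N}dt` is holomorphic on `Re z < N − 1` (dominated holomorphic family on
sub-strips `−R < Re z < N − 1 − ε`, majorant `t^{−1−ε} + t^{−R−N}`). [cite: Burnol2001CRAS, Lemme 1.2 and eq. (1.2) (TeX l.320–355)] -/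
theorem differentiableOn_ibpTail (l : ℝ) {a : ℝ} (ha : 0 < a) (N : ℕ) :
    DifferentiableOn ℂ (fun z ↦ ibpTail l a z N) {z | z.re < N - 1} := by
  intro z₀ hz₀
  -- an open strip around `z₀`
  set ε : ℝ := ((N : ℝ) - 1 - z₀.re) / 2 with hε
  have hε0 : 0 < ε := by simp only [mem_setOf_eq] at hz₀; rw [hε]; linarith
  set R : ℝ := |z₀.re| + 2 with hR
  set U : Set ℂ := {z | -R < z.re ∧ z.re < N - 1 - ε} with hU
  have hUo : IsOpen U :=
    (isOpen_lt continuous_const Complex.continuous_re).inter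
      (isOpen_lt Complex.continuous_re continuous_const)
  have hz₀U : z₀ ∈ U := by
    refine ⟨?_, ?_⟩
    · have := neg_abs_le z₀.re; rw [hR]; linarith
    · rw [hε]; simp only [mem_setOf_eq] at hz₀; linarith
  suffices h : DifferentiableOn ℂ (fun z ↦ ibpTail l a z N) U from
    (h z₀ hz₀U).differentiableAt (hUo.mem_nhds hz₀U) |>.differentiableWithinAt
  -- dominated holomorphic family
  have hB : Integrable (fun t : ℝ ↦ t ^ (-1 - ε) + t ^ (-R - N)) (volume.restrict (Ioi a)) := by
    apply Integrable.add
    · exact integrableOn_Ioi_rpow_of_lt (by linarith) ha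
    · exact integrableOn_Ioi_rpow_of_lt (by rw [hR]; have := abs_nonneg z₀.re; linarith [(N:ℕ).cast_nonneg (α := ℝ)]) ha
  refine Literature.Analysis.Fourier.differentiableOn_integral_of_dominated_holomorphic
    (μ := volume.restrict (Ioi a)) (K := fun z t ↦ cexp (I * l * t) * (t : ℂ) ^ (z - N)) hUo
    ?_ ?_ ?_ hB
  · intro z _
    refine ContinuousOn.aestronglyMeasurable (fun t ht ↦ ?_) measurableSet_Ioi
    have ht0 : (t : ℝ) ≠ 0 := (ha.trans ht).ne'
    exact ((by fun_prop : Continuous fun t : ℝ ↦ cexp (I * l * t)).continuousAt.mul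
      (continuousAt_ofReal_cpow_const _ _ (Or.inr ht0))).continuousWithinAt
  · refine (ae_restrict_mem measurableSet_Ioi).mono fun t ht ↦ ?_
    have ht0 : (t : ℂ) ≠ 0 := ofReal_ne_zero.mpr (ha.trans ht).ne'
    intro z _
    exact ((differentiableAt_const _).mul
      ((differentiableAt_id.sub_const _).const_cpow (Or.inl ht0))).differentiableWithinAt
  · refine (ae_restrict_mem measurableSet_Ioi).mono fun t ht z hz ↦ ?_
    have ht : 0 < t := ha.trans ht
    rw [norm_mul, norm_cexp_I_mul, one_mul, norm_cpow_eq_rpow_re_of_pos ht]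
    simp only [sub_re, natCast_re]
    rcases le_or_gt 1 t with ht1 | ht1
    · calc t ^ (z.re - N) ≤ t ^ (-1 - ε) := Real.rpow_le_rpow_of_exponent_le ht1 (by linarith [hz.2])
        _ ≤ t ^ (-1 - ε) + t ^ (-R - N) := le_add_of_nonneg_right (Real.rpow_nonneg ht.le _)
    · calc t ^ (z.re - N) ≤ t ^ (-R - N) :=
            Real.rpow_le_rpow_of_exponent_ge ht ht1.le (by linarith [hz.1])
        _ ≤ t ^ (-1 - ε) + t ^ (-R - N) := le_add_of_nonneg_left (Real.rpow_nonneg ht.le _)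

/-- The level-`N` continuation is holomorphic on `Re z < N − 1`. [cite: Burnol2001CRAS, Lemme 1.2 and eq. (1.2) (TeX l.320–355)] -/
theorem differentiableOn_ibpLevel (l : ℝ) {a : ℝ} (ha : 0 < a) (N : ℕ) :
    DifferentiableOn ℂ (ibpLevel l a N) {z | z.re < N - 1} := by
  unfold ibpLevel
  apply DifferentiableOn.add
  · apply DifferentiableOn.fun_sum  -- hmm name
    intro k _
    exact ((differentiable_ibpCoef l k).mul
      ((differentiable_ibpBoundary l ha).comp (differentiable_id.sub_const _))).differentiableOn
  · exact (differentiable_ibpCoef l N).differentiableOn.mul (differentiableOn_ibpTail l ha N)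

/-- RH-FREE object (proof device). The level used at `z`: `N(z) = ⌊‖z‖⌋₊ + 4`, so that `Re z < N(z) − 1`
with room to spare on the unit disc around `z`. [cite: Burnol2001CRAS, Lemme 1.2 and eq. (1.2) (TeX l.320–355)] -/
def ibpIndex (z : ℂ) : ℕ := ⌊‖z‖⌋₊ + 4

/-- `Re z < N(z) − 1`. [cite: Burnol2001CRAS, Lemme 1.2 and eq. (1.2) (TeX l.320–355)] -/
theorem re_lt_ibpIndex (z : ℂ) : z.re < (ibpIndex z : ℝ) - 1 := by
  have h1 : z.re ≤ ‖z‖ := re_le_norm z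
  have h2 : ‖z‖ < ⌊‖z‖⌋₊ + 1 := Nat.lt_floor_add_one ‖z‖
  unfold ibpIndex; push_cast; linarith

/-- RH-FREE object (proof device). **The entire continuation `J(λ,a,z)` of `z ↦ ∫_a^∞ e^{iλt} t^z dt`**
(glued from the levels; for `Re z < −1` it IS that integral, `ibpEntire_eq_integral`). Burnol's `C_a(u,w)`,
`S_a(u,w)` are `J(2πu,a,w−1) ± J(−2πu,a,w−1)` up to the factors `1`, `1/i`. Meaningful for `λ ≠ 0`,
`a > 0` (junk otherwise: division by `λ`). [cite: Burnol2001CRAS, Lemme 1.2 and eq. (1.2) (TeX l.320–355)] -/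
def ibpEntire (l a : ℝ) (z : ℂ) : ℂ := ibpLevel l a (ibpIndex z) z

/-- The glued kernel agrees with every level `M ≥ N(z)`. [cite: Burnol2001CRAS, Lemme 1.2 and eq. (1.2) (TeX l.320–355)] -/
theorem ibpEntire_eq_ibpLevel {l a : ℝ} (hl : l ≠ 0) (ha : 0 < a) {z : ℂ} {M : ℕ}
    (hM : ibpIndex z ≤ M) : ibpEntire l a z = ibpLevel l a M z := by
  rw [ibpEntire, ibpLevel_eq_of_le hl ha hM (re_lt_ibpIndex z)]

/-- The glued kernel agrees with level `M` wherever `Re z < M − 1`. [cite: Burnol2001CRAS, Lemme 1.2 and eq. (1.2) (TeX l.320–355)] -/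
theorem ibpEntire_eq_ibpLevel_of_re_lt {l a : ℝ} (hl : l ≠ 0) (ha : 0 < a) {z : ℂ} {M : ℕ}
    (hz : z.re < M - 1) : ibpEntire l a z = ibpLevel l a M z := by
  rcases le_total (ibpIndex z) M with h | h
  · exact ibpEntire_eq_ibpLevel hl ha h
  · rw [ibpEntire, ibpLevel_eq_of_le hl ha h hz]

/-- For `Re z < −1` the glued kernel is the absolutely convergent integral `∫_a^∞ e^{iλt} t^z dt`. [cite: Burnol2001CRAS, Lemme 1.2 and eq. (1.2) (TeX l.320–355)] -/
theorem ibpEntire_eq_integral {l a : ℝ} (hl : l ≠ 0) (ha : 0 < a) {z : ℂ} (hz : z.re < -1) :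
    ibpEntire l a z = ∫ t in Ioi a, cexp (I * l * t) * (t : ℂ) ^ z := by
  rw [ibpEntire_eq_ibpLevel_of_re_lt hl ha (M := 0) (by push_cast; linarith), ibpLevel_zero]

/-- On the unit disc around `z₀` the single level `⌊‖z₀‖⌋₊ + 3` is admissible. [folklore] -/
private theorem re_lt_of_mem_ball {z₀ z : ℂ} (hz : z ∈ Metric.ball z₀ 1) :
    z.re < ((⌊‖z₀‖⌋₊ + 3 : ℕ) : ℝ) - 1 := by
  rw [Metric.mem_ball] at hz
  have h1 : ‖z‖ < ‖z₀‖ + 1 := by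
    calc ‖z‖ = ‖(z - z₀) + z₀‖ := by ring_nf
      _ ≤ ‖z - z₀‖ + ‖z₀‖ := norm_add_le _ _
      _ < 1 + ‖z₀‖ := by rw [← dist_eq_norm]; linarith
      _ = ‖z₀‖ + 1 := by ring
  have h3 : z.re ≤ ‖z‖ := re_le_norm z
  have h4 : ‖z₀‖ < ⌊‖z₀‖⌋₊ + 1 := Nat.lt_floor_add_one ‖z₀‖
  push_cast; linarith

/-- **Lemme 1.2 (the heart): `z ↦ J(λ,a,z)` is entire** (`λ ≠ 0`, `a > 0`) — "La fonction `C_a(u,w)` pour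
`u > 0` fixé est une fonction entière de `w`", via the integration-by-parts relations. [cite: Burnol2001CRAS, Lemme 1.2 and eq. (1.2) (TeX l.320–355)] -/
theorem differentiable_ibpEntire {l a : ℝ} (hl : l ≠ 0) (ha : 0 < a) :
    Differentiable ℂ (ibpEntire l a) := by
  intro z₀
  set M : ℕ := ⌊‖z₀‖⌋₊ + 3 with hM
  have hev : ibpEntire l a =ᶠ[𝓝 z₀] ibpLevel l a M := by
    filter_upwards [Metric.ball_mem_nhds z₀ one_pos] with z hz
    exact ibpEntire_eq_ibpLevel_of_re_lt hl ha (re_lt_of_mem_ball hz)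
  refine (hev.differentiableAt_iff).mpr ?_
  have hz₀ : z₀.re < (M : ℝ) - 1 := by
    have := re_lt_of_mem_ball (Metric.mem_ball_self one_pos : z₀ ∈ Metric.ball z₀ 1)
    rw [hM]; exact this
  have hopen : IsOpen {z : ℂ | z.re < (M : ℝ) - 1} := isOpen_lt Complex.continuous_re continuous_const
  exact (differentiableOn_ibpLevel l ha M z₀ hz₀).differentiableAt (hopen.mem_nhds hz₀)

/-! ## K5: continuity in `l` -/

/-- The tail is continuous in `λ` (dominated convergence). [cite: Burnol2001CRAS, Lemme 1.3 (TeX l.358–367)] -/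
theorem continuous_ibpTail {a : ℝ} (ha : 0 < a) {z : ℂ} {N : ℕ} (hz : z.re < N - 1) :
    Continuous (fun l : ℝ ↦ ibpTail l a z N) := by
  unfold ibpTail
  refine continuous_of_dominated (bound := fun t ↦ t ^ (z.re - N)) ?_ ?_ ?_ ?_
  · intro l
    refine ContinuousOn.aestronglyMeasurable (fun t ht ↦ ?_) measurableSet_Ioi
    have ht0 : (t : ℝ) ≠ 0 := (ha.trans ht).ne'
    exact ((by fun_prop : Continuous fun t : ℝ ↦ cexp (I * l * t)).continuousAt.mul
      (continuousAt_ofReal_cpow_const _ _ (Or.inr ht0))).continuousWithinAt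
  · intro l
    refine (ae_restrict_mem measurableSet_Ioi).mono fun t ht ↦ ?_
    rw [norm_mul, norm_cexp_I_mul, one_mul, norm_cpow_eq_rpow_re_of_pos (ha.trans ht)]
    simp
  · have : (z.re - N : ℝ) < -1 := by linarith
    exact integrableOn_Ioi_rpow_of_lt this ha
  · refine (ae_restrict_mem measurableSet_Ioi).mono fun t _ ↦ ?_
    fun_prop

/-- The level-`N` continuation is continuous in `λ ≠ 0`. [cite: Burnol2001CRAS, Lemme 1.3 (TeX l.358–367)] -/
theorem continuousOn_ibpLevel {a : ℝ} (ha : 0 < a) {z : ℂ} {N : ℕ} (hz : z.re < N - 1) :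
    ContinuousOn (fun l : ℝ ↦ ibpLevel l a N z) {l | l ≠ 0} := by
  unfold ibpLevel ibpCoef ibpBoundary
  have htail := continuous_ibpTail ha hz
  apply ContinuousOn.add
  · apply continuousOn_finsetSum
    intro k _
    apply ContinuousOn.mul
    · apply continuousOn_finsetProd
      intro j _
      apply ContinuousOn.div continuousOn_const (by fun_prop)
      intro l hl; exact mul_ne_zero I_ne_zero (ofReal_ne_zero.mpr hl)
    · apply ContinuousOn.neg
      apply ContinuousOn.div (by fun_prop) (by fun_prop)
      intro l hl; exact mul_ne_zero I_ne_zero (ofReal_ne_zero.mpr hl)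
  · apply ContinuousOn.mul
    · apply continuousOn_finsetProd
      intro j _
      apply ContinuousOn.div continuousOn_const (by fun_prop)
      intro l hl; exact mul_ne_zero I_ne_zero (ofReal_ne_zero.mpr hl)
    · exact htail.continuousOn

/-- `λ ↦ J(λ,a,z)` is continuous on `λ ≠ 0` (for the measurability of `u ↦ C_a(u,w)`; Burnol: analytic in
`u ∈ ℂ ∖ ]−∞,0]`, Lemme 1.3 — only continuity is proved here). [cite: Burnol2001CRAS, Lemme 1.3 (TeX l.358–367)] -/
theorem continuousOn_ibpEntire {a : ℝ} (ha : 0 < a) (z : ℂ) :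
    ContinuousOn (fun l : ℝ ↦ ibpEntire l a z) {l | l ≠ 0} := by
  have h := continuousOn_ibpLevel ha (re_lt_ibpIndex z) (N := ibpIndex z)
  exact h.congr fun l _ ↦ rfl


/-! ## K3: the uniform bound `O(1/|l|)` for `‖z‖ ≤ R` -/

/-- `|c_k(z)| ≤ ((R+k)/|λ|)^k` for `‖z‖ ≤ R`. [cite: Burnol2001CRAS, Lemme 1.3 (TeX l.358–367)] -/
theorem norm_ibpCoef_le {l : ℝ} (hl : l ≠ 0) {z : ℂ} {R : ℝ} (hR : ‖z‖ ≤ R) (k : ℕ) :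
    ‖ibpCoef l z k‖ ≤ ((R + k) / |l|) ^ k := by
  have hR0 : 0 ≤ R := (norm_nonneg z).trans hR
  have hl' : 0 < |l| := abs_pos.mpr hl
  induction k with
  | zero => simp [ibpCoef]
  | succ k ih =>
    rw [ibpCoef_succ, norm_mul]
    have h1 : ‖-(z - (k : ℂ)) / (I * (l : ℂ))‖ ≤ (R + k) / |l| := by
      rw [norm_div, norm_neg, norm_mul, norm_I, one_mul, Complex.norm_real, Real.norm_eq_abs]
      gcongr
      calc ‖z - (k : ℂ)‖ ≤ ‖z‖ + ‖(k : ℂ)‖ := norm_sub_le _ _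
        _ ≤ R + k := by simp [hR]
    calc ‖ibpCoef l z k‖ * ‖-(z - (k : ℂ)) / (I * (l : ℂ))‖
        ≤ ((R + k) / |l|) ^ k * ((R + k) / |l|) := by
          apply mul_le_mul ih h1 (norm_nonneg _) (by positivity)
      _ = ((R + k) / |l|) ^ (k + 1) := by ring
      _ ≤ ((R + (k + 1 : ℕ)) / |l|) ^ (k + 1) := by
          gcongr
          · linarith

/-- `|bnd(λ,a,w)| = a^{Re w}/|λ|`. [cite: Burnol2001CRAS, Lemme 1.3 (TeX l.358–367)] -/
theorem norm_ibpBoundary (l : ℝ) {a : ℝ} (ha : 0 < a) (w : ℂ) :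
    ‖ibpBoundary l a w‖ = a ^ w.re / |l| := by
  rw [ibpBoundary, norm_neg, norm_div, norm_mul, norm_cexp_I_mul, one_mul,
    norm_cpow_eq_rpow_re_of_pos ha, norm_mul, norm_I, one_mul, Complex.norm_real, Real.norm_eq_abs]

/-- `a^x ≤ (max a a⁻¹)^|x|` for `a > 0`. [folklore] -/
private theorem rpow_le_max_rpow_abs {a : ℝ} (ha : 0 < a) (x : ℝ) : a ^ x ≤ (max a a⁻¹) ^ |x| := by
  rcases le_or_gt 1 a with h1 | h1
  · have hm : max a a⁻¹ = a := max_eq_left ((inv_le_one_of_one_le₀ h1).trans h1)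
    rw [hm]
    exact Real.rpow_le_rpow_of_exponent_le h1 (le_abs_self x)
  · have hinv : 1 ≤ a⁻¹ := by rw [le_inv_comm₀ one_pos ha, inv_one]; exact h1.le
    have hm : max a a⁻¹ = a⁻¹ := max_eq_right (h1.le.trans hinv)
    rw [hm]
    calc a ^ x = a⁻¹ ^ (-x) := by rw [Real.inv_rpow ha.le, Real.rpow_neg ha.le, inv_inv]
      _ ≤ a⁻¹ ^ |x| := Real.rpow_le_rpow_of_exponent_le hinv (neg_le_abs x)

/-- `1 ≤ max a a⁻¹` for `a > 0`. [folklore] -/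
private theorem one_le_max_inv {a : ℝ} (ha : 0 < a) : 1 ≤ max a a⁻¹ := by
  rcases le_or_gt 1 a with h1 | h1
  · exact h1.trans (le_max_left _ _)
  · have hinv : 1 ≤ a⁻¹ := by rw [le_inv_comm₀ one_pos ha, inv_one]; exact h1.le
    exact hinv.trans (le_max_right _ _)

/-- `|∫_a^∞ e^{iλt} t^w dt| ≤ a^{Re w + 1}` when `Re w ≤ −2` (`a > 0`). [folklore] -/
private theorem norm_integral_cexp_cpow_le {l a : ℝ} (ha : 0 < a) {w : ℂ} (hw : w.re ≤ -2) :
    ‖∫ t in Ioi a, cexp (I * l * t) * (t : ℂ) ^ w‖ ≤ a ^ (w.re + 1) := by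
  have hw' : w.re < -1 := by linarith
  calc ‖∫ t in Ioi a, cexp (I * l * t) * (t : ℂ) ^ w‖
      ≤ ∫ t in Ioi a, t ^ w.re := by
        refine norm_integral_le_of_norm_le (integrableOn_Ioi_rpow_of_lt hw' ha) ?_
        refine (ae_restrict_mem measurableSet_Ioi).mono fun t ht ↦ ?_
        rw [norm_mul, norm_cexp_I_mul, one_mul, norm_cpow_eq_rpow_re_of_pos (ha.trans ht)]
    _ = -a ^ (w.re + 1) / (w.re + 1) := integral_Ioi_rpow_of_lt hw' ha
    _ = a ^ (w.re + 1) * (1 / (-(w.re + 1))) := by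
        field_simp
    _ ≤ a ^ (w.re + 1) * 1 := by
        apply mul_le_mul_of_nonneg_left _ (Real.rpow_nonneg ha.le _)
        rw [div_le_one (by linarith)]; linarith
    _ = a ^ (w.re + 1) := mul_one _

/-- **Lemme 1.3, the `O(1/u)` clause**: `‖J(λ,a,z)‖ ≤ K(a,λ₀,R)/|λ|` for `|λ| ≥ λ₀ > 0` and `‖z‖ ≤ R` — "Elle
est `O(1/u)` sur `[1,∞[`, et cela uniformément par rapport à `w` lorsque `|w|` est borné" (here on `|λ| ≥ λ₀`,
any `λ₀ > 0`). [cite: Burnol2001CRAS, Lemme 1.3 (TeX l.358–367)] -/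
theorem exists_bound_ibpEntire {a : ℝ} (ha : 0 < a) {l₀ : ℝ} (hl₀ : 0 < l₀) (R : ℝ) :
    ∃ K : ℝ, 0 ≤ K ∧ ∀ (l : ℝ) (z : ℂ), l₀ ≤ |l| → ‖z‖ ≤ R → ‖ibpEntire l a z‖ ≤ K / |l| := by
  -- WLOG `0 ≤ R`
  wlog hR0 : 0 ≤ R generalizing R
  · refine ⟨0, le_rfl, fun l z _ hz ↦ ?_⟩
    have : R < 0 := lt_of_not_ge hR0
    have := (norm_nonneg z).trans hz
    linarith
  set M' : ℕ := ⌊R⌋₊ + 3 with hM'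
  set M : ℕ := M' + 1 with hM
  set α : ℝ := max a a⁻¹ with hα
  have hα1 : 1 ≤ α := one_le_max_inv ha
  set D : ℝ := (R + M) / l₀ with hD
  have hD0 : 0 ≤ D := by positivity
  set K : ℝ := (∑ k ∈ Finset.range M, D ^ k * α ^ (R + M)) + D ^ M' * (R + M) * α ^ (R + M) with hK
  refine ⟨K, by positivity, fun l z hl hz ↦ ?_⟩
  have hl0 : l ≠ 0 := by intro h; rw [h, abs_zero] at hl; linarith
  have hla : 0 < |l| := abs_pos.mpr hl0
  -- the glued kernel is the level `M`
  have hidx : ibpIndex z ≤ M := by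
    unfold ibpIndex; rw [hM, hM']
    have : ⌊‖z‖⌋₊ ≤ ⌊R⌋₊ := Nat.floor_le_floor hz
    omega
  rw [ibpEntire_eq_ibpLevel hl0 ha hidx, ibpLevel]
  -- bounds on the pieces
  have hRM : ‖z‖ ≤ R + M := hz.trans (le_add_of_nonneg_right (by positivity))
  have hcoef : ∀ k, k ≤ M → ‖ibpCoef l z k‖ ≤ D ^ k := by
    intro k hk
    calc ‖ibpCoef l z k‖ ≤ ((R + k) / |l|) ^ k := norm_ibpCoef_le hl0 hz k
      _ ≤ D ^ k := by
          apply pow_le_pow_left₀ (by positivity)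
          rw [hD]
          gcongr
  have hexp : ∀ x : ℝ, |x| ≤ R + M → a ^ x ≤ α ^ (R + M) := fun x hx ↦
    (rpow_le_max_rpow_abs ha x).trans (Real.rpow_le_rpow_of_exponent_le hα1 hx)
  have hre : |z.re| ≤ ‖z‖ := abs_re_le_norm z
  -- the sum
  have hsum : ‖∑ k ∈ Finset.range M, ibpCoef l z k * ibpBoundary l a (z - k)‖ ≤
      (∑ k ∈ Finset.range M, D ^ k * α ^ (R + M)) / |l| := by
    rw [Finset.sum_div]
    refine (norm_sum_le _ _).trans (Finset.sum_le_sum fun k hk ↦ ?_)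
    rw [Finset.mem_range] at hk
    rw [norm_mul, norm_ibpBoundary l ha, ← mul_div_assoc]
    gcongr
    · exact hcoef k hk.le
    · apply hexp
      simp only [sub_re, natCast_re]
      have hkR : (k : ℝ) ≤ M := by exact_mod_cast hk.le
      rw [abs_le]; rw [abs_le] at hre
      constructor <;> linarith [hre.1, hre.2, hz]
  -- the tail term
  have htail : ‖ibpCoef l z M * ibpTail l a z M‖ ≤ D ^ M' * (R + M) * α ^ (R + M) / |l| := by
    rw [norm_mul, hM, ibpCoef_succ, norm_mul]
    have h1 : ‖ibpCoef l z M'‖ ≤ D ^ M' := hcoef M' (by omega)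
    have h2 : ‖-(z - (M' : ℂ)) / (I * (l : ℂ))‖ ≤ (R + M) / |l| := by
      rw [norm_div, norm_neg, norm_mul, norm_I, one_mul, Complex.norm_real, Real.norm_eq_abs]
      gcongr
      calc ‖z - (M' : ℂ)‖ ≤ ‖z‖ + ‖(M' : ℂ)‖ := norm_sub_le _ _
        _ ≤ R + M := by
            simp only [Complex.norm_natCast]; rw [hM]; push_cast; linarith
    have h3 : ‖ibpTail l a z (M' + 1)‖ ≤ α ^ (R + M) := by
      rw [ibpTail]
      have hw : (z - ((M' + 1 : ℕ) : ℂ)).re ≤ -2 := by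
        simp only [sub_re, natCast_re]
        have : z.re ≤ R := (le_abs_self _).trans (hre.trans hz)
        have : (R : ℝ) < ⌊R⌋₊ + 1 := Nat.lt_floor_add_one R
        rw [hM']; push_cast; linarith
      refine (norm_integral_cexp_cpow_le ha hw).trans (hexp _ ?_)
      simp only [sub_re, natCast_re]
      rw [abs_le]; rw [abs_le] at hre
      rw [hM]; constructor <;> push_cast <;> linarith [hre.1, hre.2, hz]
    calc ‖ibpCoef l z M'‖ * ‖-(z - (M' : ℂ)) / (I * (l : ℂ))‖ * ‖ibpTail l a z (M' + 1)‖
        ≤ D ^ M' * ((R + M) / |l|) * α ^ (R + M) := by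
          apply mul_le_mul (mul_le_mul h1 h2 (norm_nonneg _) (by positivity)) h3 (norm_nonneg _)
            (by positivity)
      _ = D ^ M' * (R + M) * α ^ (R + M) / |l| := by ring
  calc ‖(∑ k ∈ Finset.range M, ibpCoef l z k * ibpBoundary l a (z - k)) +
        ibpCoef l z M * ibpTail l a z M‖
      ≤ ‖∑ k ∈ Finset.range M, ibpCoef l z k * ibpBoundary l a (z - k)‖ +
        ‖ibpCoef l z M * ibpTail l a z M‖ := norm_add_le _ _
    _ ≤ (∑ k ∈ Finset.range M, D ^ k * α ^ (R + M)) / |l| +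
        D ^ M' * (R + M) * α ^ (R + M) / |l| := add_le_add hsum htail
    _ = K / |l| := by rw [hK]; ring


/-! ## K4: the value at an even natural number (terminating integration by parts) -/

/-- At `z = m ∈ ℕ` the coefficients `c_k(m)`, `k > m`, vanish (the factor `j = m`): the integration by parts
TERMINATES. [cite: Burnol2001CRAS, Lemme 1.3 (TeX l.358–367)] -/
theorem ibpCoef_natCast_eq_zero {l : ℝ} {m k : ℕ} (hk : m < k) : ibpCoef l (m : ℂ) k = 0 := by
  unfold ibpCoef
  exact Finset.prod_eq_zero (Finset.mem_range.mpr hk) (by simp)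

/-- At `z = m ∈ ℕ`, `J(λ,a,m) = Σ_{k≤m} c_k(m)·bnd(λ,a,m−k)` is a finite boundary sum. [cite: Burnol2001CRAS, Lemme 1.3 (TeX l.358–367)] -/
theorem ibpEntire_natCast {l a : ℝ} (hl : l ≠ 0) (ha : 0 < a) (m : ℕ) :
    ibpEntire l a (m : ℂ) =
      ∑ k ∈ Finset.range (m + 1), ibpCoef l (m : ℂ) k * ibpBoundary l a ((m : ℂ) - k) := by
  rw [ibpEntire_eq_ibpLevel_of_re_lt hl ha (M := m + 2) (by simp only [natCast_re]; push_cast; linarith),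
    ibpLevel,
    Finset.sum_range_succ, ibpCoef_natCast_eq_zero (by omega : m < m + 1),
    ibpCoef_natCast_eq_zero (by omega : m < m + 2)]
  simp

/-- RH-FREE object (proof device). The finite oscillatory moment `Q_n(λ,a) = ∫_0^a e^{iλt} t^n dt`
(`D_a(u,w) = 2∫_0^a cos(2πut)t^{w−1}dt` of Lemme 1.3 at `w = n + 1` is `Q_n(2πu,a) + Q_n(−2πu,a)`).
[cite: Burnol2001CRAS, Lemme 1.3 (TeX l.358–367)] -/
def oscMoment (l a : ℝ) (n : ℕ) : ℂ := ∫ t in (0 : ℝ)..a, cexp (I * l * t) * (t : ℂ) ^ n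

/-- `Q_0 = (e^{iλa} − 1)/(iλ)`. [cite: Burnol2001CRAS, Lemme 1.3 (TeX l.358–367)] -/
theorem oscMoment_zero {l a : ℝ} (hl : l ≠ 0) :
    oscMoment l a 0 = cexp (I * l * a) / (I * l) - 1 / (I * l) := by
  have hIl : (I * l : ℂ) ≠ 0 := mul_ne_zero I_ne_zero (ofReal_ne_zero.mpr hl)
  unfold oscMoment
  simp only [pow_zero, mul_one]
  have hderiv : ∀ x ∈ Set.uIcc (0 : ℝ) a,
      HasDerivAt (fun t : ℝ ↦ cexp (I * l * t) / (I * l)) (cexp (I * l * x)) x := by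
    intro x _
    refine ((hasDerivAt_cexp_mul l x).div_const (I * l)).congr_deriv ?_
    exact mul_div_cancel_left₀ _ hIl
  rw [intervalIntegral.integral_eq_sub_of_hasDerivAt hderiv
    ((by fun_prop : Continuous fun t : ℝ ↦ cexp (I * l * t)).intervalIntegrable _ _)]
  simp

/-- `Q_{n+1} = e^{iλa}a^{n+1}/(iλ) − ((n+1)/(iλ)) Q_n` (integration by parts on `[0,a]`). [cite: Burnol2001CRAS, Lemme 1.3 (TeX l.358–367)] -/
theorem oscMoment_succ {l a : ℝ} (hl : l ≠ 0) (n : ℕ) :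
    oscMoment l a (n + 1) =
      cexp (I * l * a) * (a : ℂ) ^ (n + 1) / (I * l) - ((n + 1 : ℂ) / (I * l)) * oscMoment l a n := by
  have hIl : (I * l : ℂ) ≠ 0 := mul_ne_zero I_ne_zero (ofReal_ne_zero.mpr hl)
  unfold oscMoment
  have hu : ∀ x ∈ Set.uIcc (0 : ℝ) a,
      HasDerivAt (fun t : ℝ ↦ (t : ℂ) ^ (n + 1)) (((n + 1 : ℕ) : ℂ) * (x : ℂ) ^ n * 1) x := by
    intro x _
    have := ((hasDerivAt_id x).ofReal_comp).fun_pow (n + 1)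
    simpa using this
  have hv : ∀ x ∈ Set.uIcc (0 : ℝ) a,
      HasDerivAt (fun t : ℝ ↦ cexp (I * l * t) / (I * l)) (cexp (I * l * x)) x := by
    intro x _
    refine ((hasDerivAt_cexp_mul l x).div_const (I * l)).congr_deriv ?_
    exact mul_div_cancel_left₀ _ hIl
  have key := intervalIntegral.integral_mul_deriv_eq_deriv_mul hu hv
    ((by fun_prop : Continuous fun x : ℝ ↦ ((n + 1 : ℕ) : ℂ) * (x : ℂ) ^ n * 1).intervalIntegrable
      _ _)
    ((by fun_prop : Continuous fun t : ℝ ↦ cexp (I * l * t)).intervalIntegrable _ _)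
  have e1 : ∫ t in (0 : ℝ)..a, cexp (I * l * t) * (t : ℂ) ^ (n + 1) =
      ∫ t in (0 : ℝ)..a, (t : ℂ) ^ (n + 1) * cexp (I * l * t) := by
    congr 1; ext t; ring
  have e2 : ∫ x in (0 : ℝ)..a, ((n + 1 : ℕ) : ℂ) * (x : ℂ) ^ n * 1 * (cexp (I * l * x) / (I * l)) =
      ((n + 1 : ℂ) / (I * l)) * ∫ t in (0 : ℝ)..a, cexp (I * l * t) * (t : ℂ) ^ n := by
    rw [← intervalIntegral.integral_const_mul]
    congr 1; ext t; push_cast; field_simp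
  rw [e1, key, e2]
  simp
  field_simp

/-- Reindexing of the coefficients: `c_{k+1}(n+1) = (−(n+1)/(iλ))·c_k(n)`. [cite: Burnol2001CRAS, Lemme 1.3 (TeX l.358–367)] -/
theorem ibpCoef_succ_succ (l : ℝ) (n k : ℕ) :
    ibpCoef l ((n + 1 : ℕ) : ℂ) (k + 1) = (-((n + 1 : ℂ)) / (I * l)) * ibpCoef l (n : ℂ) k := by
  unfold ibpCoef
  rw [Finset.prod_range_succ', mul_comm]
  congr 1
  · push_cast; ring
  · apply Finset.prod_congr rfl
    intro j _
    push_cast; ring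

/-- The unrolled recursion `Q_n = −Σ_{k≤n} c_k(n)·bnd(λ,a,n−k) − c_n(n)/(iλ)`. [cite: Burnol2001CRAS, Lemme 1.3 (TeX l.358–367)] -/
theorem oscMoment_eq {l : ℝ} (hl : l ≠ 0) (a : ℝ) (n : ℕ) :
    oscMoment l a n =
      -(∑ k ∈ Finset.range (n + 1), ibpCoef l (n : ℂ) k * ibpBoundary l a ((n : ℂ) - k)) -
        ibpCoef l (n : ℂ) n / (I * l) := by
  have hIl : (I * l : ℂ) ≠ 0 := mul_ne_zero I_ne_zero (ofReal_ne_zero.mpr hl)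
  induction n with
  | zero =>
    rw [oscMoment_zero hl]
    simp [ibpCoef, ibpBoundary]
  | succ n ih =>
    rw [oscMoment_succ hl, ih, Finset.sum_range_succ' _ (n + 1)]
    have e1 : ibpCoef l ((n + 1 : ℕ) : ℂ) 0 * ibpBoundary l a (((n + 1 : ℕ) : ℂ) - ((0 : ℕ) : ℂ)) =
        -(cexp (I * l * a) * (a : ℂ) ^ (n + 1) / (I * l)) := by
      rw [ibpCoef_zero, one_mul, ibpBoundary]
      congr 2
      push_cast
      rw [sub_zero, ← Nat.cast_succ, cpow_natCast]
    have e3 : ∑ k ∈ Finset.range (n + 1), ibpCoef l ((n + 1 : ℕ) : ℂ) (k + 1) *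
          ibpBoundary l a (((n + 1 : ℕ) : ℂ) - ((k + 1 : ℕ) : ℂ)) =
        (-((n + 1 : ℂ)) / (I * l)) *
          ∑ k ∈ Finset.range (n + 1), ibpCoef l (n : ℂ) k * ibpBoundary l a ((n : ℂ) - k) := by
      rw [Finset.mul_sum]
      apply Finset.sum_congr rfl
      intro k _
      rw [ibpCoef_succ_succ]
      have : (((n + 1 : ℕ) : ℂ) - ((k + 1 : ℕ) : ℂ)) = (n : ℂ) - k := by push_cast; ring
      rw [this]; ring
    have e4 : ibpCoef l ((n + 1 : ℕ) : ℂ) (n + 1) = (-((n + 1 : ℂ)) / (I * l)) * ibpCoef l (n : ℂ) n :=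
      ibpCoef_succ_succ l n n
    rw [e1, e3, e4]
    have hl' : (l : ℂ) ≠ 0 := ofReal_ne_zero.mpr hl
    field_simp
    ring

/-- `c_k(z)(−λ) = (−1)^k c_k(z)(λ)`. [cite: Burnol2001CRAS, Lemme 1.3 (TeX l.358–367)] -/
theorem ibpCoef_neg (l : ℝ) (z : ℂ) (k : ℕ) : ibpCoef (-l) z k = (-1) ^ k * ibpCoef l z k := by
  unfold ibpCoef
  rw [show ((-1 : ℂ)) ^ k = ∏ _j ∈ Finset.range k, (-1 : ℂ) by simp, ← Finset.prod_mul_distrib]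
  apply Finset.prod_congr rfl
  intro j _
  rw [show (I * ((-l : ℝ) : ℂ)) = -(I * l) by push_cast; ring, div_neg]
  ring

/-- **Terminating integration by parts at even integers**:
`J(λ,a,2j) + J(−λ,a,2j) = −(Q_{2j}(λ,a) + Q_{2j}(−λ,a))`, i.e. `C_a(u,1+2j) = −D_a(u,1+2j)` — the content of
"`C_a(u,1+2j) = −𝓕₊(𝟙_{t≤a}t^{2j})(u)` pour `j ∈ ℕ`" (Burnol derives it from (1.3) and `γ₊(1+2j) = 0`; here it
is the cancellation of the two `t = 0` boundary terms `∓(2j)! i^{2j+1}/λ^{2j+1}`). [cite: Burnol2001CRAS, Lemme 1.3 (TeX l.358–367)] -/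
theorem ibpEntire_add_ibpEntire_neg_even {l a : ℝ} (hl : l ≠ 0) (ha : 0 < a) (j : ℕ) :
    ibpEntire l a ((2 * j : ℕ) : ℂ) + ibpEntire (-l) a ((2 * j : ℕ) : ℂ) =
      -(oscMoment l a (2 * j) + oscMoment (-l) a (2 * j)) := by
  have hl' : -l ≠ 0 := neg_ne_zero.mpr hl
  have hIl : (I * l : ℂ) ≠ 0 := mul_ne_zero I_ne_zero (ofReal_ne_zero.mpr hl)
  rw [ibpEntire_natCast hl ha, ibpEntire_natCast hl' ha, oscMoment_eq hl a, oscMoment_eq hl' a,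
    ibpCoef_neg]
  have : ((-1 : ℂ)) ^ (2 * j) = 1 := by rw [pow_mul]; simp
  rw [this]
  push_cast
  field_simp
  ring

/-! ## The cosine kernel `C_a(u,w)` and the candidate continuation `∫_b^∞ F(u) C_a(u,w) du` -/

/-- RH-FREE object. **Burnol's kernel `C_a(u,w) = 2∫_a^∞ cos(2πut) t^{w−1} dt`, continued to an entire
function of `w`**: `J(2πu,a,w−1) + J(−2πu,a,w−1)`. Even in `u`; meaningful for `u ≠ 0`, `a > 0`.
[cite: Burnol2001CRAS, Lemme 1.2 (TeX l.338–355)] -/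
def cosKernel (a u : ℝ) (w : ℂ) : ℂ :=
  ibpEntire (2 * π * u) a (w - 1) + ibpEntire (-(2 * π * u)) a (w - 1)

/-- `C_a(−u,w) = C_a(u,w)`. [cite: Burnol2001CRAS, Lemme 1.2 (TeX l.338–355)] -/
theorem cosKernel_neg (a u : ℝ) (w : ℂ) : cosKernel a (-u) w = cosKernel a u w := by
  rw [cosKernel, cosKernel, add_comm]
  congr 2 <;> ring

/-- **Lemme 1.2**: `w ↦ C_a(u,w)` is entire (`a > 0`, `u ≠ 0`). [cite: Burnol2001CRAS, Lemme 1.2 (TeX l.354–355)] -/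
theorem differentiable_cosKernel {a u : ℝ} (ha : 0 < a) (hu : u ≠ 0) :
    Differentiable ℂ (cosKernel a u) := by
  have h1 : (2 * π * u : ℝ) ≠ 0 := by positivity
  have h2 : (-(2 * π * u) : ℝ) ≠ 0 := neg_ne_zero.mpr h1
  unfold cosKernel
  exact ((differentiable_ibpEntire h1 ha).comp (differentiable_id.sub_const 1)).add
    ((differentiable_ibpEntire h2 ha).comp (differentiable_id.sub_const 1))

/-- For `Re w < 0`, `C_a(u,w) = ∫_a^∞ (e^{2πiut} + e^{−2πiut}) t^{w−1} dt` (absolutely convergent).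
[cite: Burnol2001CRAS, Lemme 1.2 and eq. (1.2) (TeX l.338–355)] -/
theorem cosKernel_eq_integral {a u : ℝ} (ha : 0 < a) (hu : u ≠ 0) {w : ℂ} (hw : w.re < 0) :
    cosKernel a u w = ∫ t in Ioi a,
      (cexp (I * (2 * π * u) * t) + cexp (I * (-(2 * π * u)) * t)) * (t : ℂ) ^ (w - 1) := by
  have h1 : (2 * π * u : ℝ) ≠ 0 := by positivity
  have h2 : (-(2 * π * u) : ℝ) ≠ 0 := neg_ne_zero.mpr h1
  have hw' : (w - 1).re < -1 := by simp; linarith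
  rw [cosKernel, ibpEntire_eq_integral h1 ha hw', ibpEntire_eq_integral h2 ha hw',
    ← integral_add (integrableOn_cexp_mul_cpow ha hw') (integrableOn_cexp_mul_cpow ha hw')]
  refine setIntegral_congr_fun measurableSet_Ioi (fun t _ ↦ ?_)
  push_cast
  ring

/-- For `Re w < 0`, `C_a(u,w)` IS Burnol's `2∫_a^∞ cos(2πut) t^{w−1} dt`
(`Literature.Analysis.DeBrangesSpaces.Burnol2001.burnolC`). [cite: Burnol2001CRAS, Lemme 1.2 (TeX l.338–355)] -/
theorem cosKernel_eq_burnolC {a u : ℝ} (ha : 0 < a) (hu : u ≠ 0) {w : ℂ} (hw : w.re < 0) :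
    cosKernel a u w = Burnol2001.burnolC a u w := by
  rw [cosKernel_eq_integral ha hu hw, Burnol2001.burnolC, ← integral_const_mul]
  refine setIntegral_congr_fun measurableSet_Ioi (fun t _ ↦ ?_)
  rw [Complex.ofReal_cos, show ((2 * π * u * t : ℝ) : ℂ) = ((2 * π * u : ℝ) : ℂ) * (t : ℂ) by push_cast; ring]
  conv_rhs => rw [← mul_assoc, Complex.two_cos]
  congr 2
  · congr 1; push_cast; ring
  · congr 1; push_cast; ring

/-- `u ↦ C_a(u,w)` is continuous on `u ≠ 0`. [cite: Burnol2001CRAS, Lemme 1.3 (TeX l.358–367)] -/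
theorem continuousOn_cosKernel {a : ℝ} (ha : 0 < a) (w : ℂ) :
    ContinuousOn (fun u : ℝ ↦ cosKernel a u w) {u | u ≠ 0} := by
  have hc := continuousOn_ibpEntire ha (w - 1)
  have hm1 : MapsTo (fun u : ℝ ↦ 2 * π * u) {u : ℝ | u ≠ 0} {l : ℝ | l ≠ 0} := fun u hu ↦ by
    simp only [mem_setOf_eq] at hu ⊢; positivity
  have hm2 : MapsTo (fun u : ℝ ↦ -(2 * π * u)) {u : ℝ | u ≠ 0} {l : ℝ | l ≠ 0} := fun u hu ↦ by
    simp only [mem_setOf_eq] at hu ⊢; exact neg_ne_zero.mpr (by positivity)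
  exact (hc.comp (by fun_prop) hm1).add (hc.comp (by fun_prop) hm2)

/-- **The `O(1/u)` clause of Lemme 1.3 for the kernel**: `‖C_a(u,w)‖ ≤ K(a,u₀,R)/|u|` for `|u| ≥ u₀ > 0`,
`‖w‖ ≤ R`. [cite: Burnol2001CRAS, Lemme 1.3 (TeX l.358–367)] -/
theorem exists_bound_cosKernel {a : ℝ} (ha : 0 < a) {u₀ : ℝ} (hu₀ : 0 < u₀) (R : ℝ) :
    ∃ K : ℝ, 0 ≤ K ∧ ∀ (u : ℝ) (w : ℂ), u₀ ≤ |u| → ‖w‖ ≤ R → ‖cosKernel a u w‖ ≤ K / |u| := by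
  obtain ⟨K, hK0, hK⟩ := exists_bound_ibpEntire ha (l₀ := 2 * π * u₀) (by positivity) (R + 1)
  refine ⟨K / π, by positivity, fun u w hu hw ↦ ?_⟩
  have hu0 : 0 < |u| := hu₀.trans_le hu
  have hl : 2 * π * u₀ ≤ |2 * π * u| := by
    rw [abs_mul, abs_of_pos (by positivity : (0 : ℝ) < 2 * π)]; nlinarith [Real.pi_pos]
  have hl' : 2 * π * u₀ ≤ |(-(2 * π * u))| := by rwa [abs_neg]
  have hw' : ‖w - 1‖ ≤ R + 1 := by
    calc ‖w - 1‖ ≤ ‖w‖ + ‖(1 : ℂ)‖ := norm_sub_le _ _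
      _ ≤ R + 1 := by simp [hw]
  calc ‖cosKernel a u w‖ ≤ ‖ibpEntire (2 * π * u) a (w - 1)‖ + ‖ibpEntire (-(2 * π * u)) a (w - 1)‖ :=
        norm_add_le _ _
    _ ≤ K / |2 * π * u| + K / |(-(2 * π * u))| := add_le_add (hK _ _ hl hw') (hK _ _ hl' hw')
    _ = K / π / |u| := by
        rw [abs_neg, abs_mul, abs_of_pos (by positivity : (0 : ℝ) < 2 * π)]
        field_simp
        ring

/-- **The value at `1 + 2j`**: `C_a(u,1+2j) = −∫_0^a (e^{2πiut}+e^{−2πiut}) t^{2j} dt = −2∫_0^a cos(2πut)t^{2j}dt`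
("`C_a(u,1+2j) = −𝓕₊(𝟙_{t≤a}t^{2j})(u)`"). [cite: Burnol2001CRAS, Lemme 1.3 (TeX l.366–367)] -/
theorem cosKernel_one_add_two_mul {a u : ℝ} (ha : 0 < a) (hu : u ≠ 0) (j : ℕ) :
    cosKernel a u (1 + 2 * j) =
      -(oscMoment (2 * π * u) a (2 * j) + oscMoment (-(2 * π * u)) a (2 * j)) := by
  have h1 : (2 * π * u : ℝ) ≠ 0 := by positivity
  rw [cosKernel, show (1 + 2 * (j : ℂ) - 1) = ((2 * j : ℕ) : ℂ) by push_cast; ring,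
    ibpEntire_add_ibpEntire_neg_even h1 ha j]

/-- RH-FREE object. **The candidate entire continuation of the Mellin transform of a Sonine function**:
`G(w) = ∫_b^∞ F(u) C_a(u,w) du`, the right-hand side of Burnol's (1.2) with `F = 𝓕₊f` (for `f ∈ K_{a,b}`
it IS the entire continuation of `∫_0^∞ f(t)t^{w−1}dt`, `SonineMellinEntire.lean`).
[cite: Burnol2001CRAS, eq. (1.2) (TeX l.326–332)] -/
def sonineMellinExt (a b : ℝ) (F : ℝ → ℂ) (w : ℂ) : ℂ :=
  ∫ u in Ioi b, F u * cosKernel a u w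

end SonineMellin

/-! ## Discharge of Lemme 1.2 -/

namespace Burnol2001

/-- **Lemme 1.2 holds**: for `a > 0`, `u > 0` the function `w ↦ C_a(u,w) = 2∫_a^∞cos(2πut)t^{w−1}dt`
(`Re w < 0`) has an entire continuation — namely `SonineMellin.cosKernel a u`.
[cite: Burnol2001CRAS, Lemme 1.2 (TeX l.354–355)] -/
theorem Burnol2001CRAS_lem1_2_holds : Burnol2001CRAS_lem1_2 := by
  intro a u ha hu
  exact ⟨SonineMellin.cosKernel a u, SonineMellin.differentiable_cosKernel ha hu.ne',
    fun w hw ↦ SonineMellin.cosKernel_eq_burnolC ha hu.ne' hw⟩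

end Burnol2001

end Literature.Analysis.DeBrangesSpaces
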